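import Summits.ValiantsHypothesis.ValiantsHypothesis.Theses.KPlusLogSqLaw
import Summits.ValiantsHypothesis.ValiantsHypothesis.Theorems.KPlusLogSqLawTropicalBDoubling
import Summits.ValiantsHypothesis.ValiantsHypothesis.Theorems.KPlusLogSqLawTropicalBSignsFree

/-!
# Route «KPlusLogSqLaw», crux `TropicalB` (stmt-ValiantsHypothesis-19771) — the balanced doubling law in the crux's own (SIGNED)
# currency implies `TropicalB` (CONDITIONAL composition; the law is NOT claimed)

HONEST FRAMING.  Helper file of the object-search cell `pub-symmetroid` (seat val-sym-trop-p2 g3) for the crux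
`Summit.ValiantsHypothesis.ValiantsHypothesis.Theses.KPlusLogSqLaw.TropicalB` (ledger item `stmt-ValiantsHypothesis-19771`, route
`KPlusLogSqLaw`), landed `--supports`; it does NOT close the item.  An IMPLICATION between OPEN statements; nothing is asserted about
`TropicalB`, `WeakLifting`, `KPlusLogSqLaw`, `MatrixDescartes` (stmt-ValiantsHypothesis-18050) or `VP ≠ VNP`, and the hypothesis is NOT
claimed.

Companion of `…TropicalBDoubling` (`Doubling.tropicalB_of_doubling_ge`: the balanced doubling law for the UNSIGNED rows `TropRowD`, from
size `K` on, implies `TropicalB`).  Here the same law is stated for the SIGNED rows `TropicalCensus.TropRootLawAt` — the currency of the crux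
and of the birth skeleton's `TropRow` (`Iff.rfl`) — so that the custody can register it verbatim if it wishes:
* `Doubling.tropRowD_doubling_of_signed` — the signed law with exponent `c` gives the unsigned law with exponent `c + 1` (signs are worth a
  factor two: val-sym-trop-p2 g2's `tropRowD_of_tropRootLawAt`, `…TropicalBSignsFree`, and `2·(a+e)^c ≤ (a+e)^{c+1}` once `a + e ≥ 2`; the
  degenerate sizes `a + e ≤ 1` are slope counting);
* `Doubling.tropicalB_of_signedDoubling` — **the signed balanced doubling law from size `K` on implies `TropicalB`**, `C = 6(c+3) + 5`.
[folklore: Gusfield's dyadic recursion; the packaging is the cell's]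
-/

-- `Summit.ValiantsHypothesis.ValiantsHypothesis.…` repeats a component by the D-0017 layout
-- (single-conjunct summit), which the `dupNamespace` linter flags; the name is mandated.
set_option linter.dupNamespace false
set_option autoImplicit false

namespace Summit.ValiantsHypothesis.ValiantsHypothesis.Theorems.KPlusLogSqLaw

open Summit.ValiantsHypothesis.ValiantsHypothesis.Theorems.MatrixDescartes.Negative
open Summit.ValiantsHypothesis.ValiantsHypothesis.Theorems.LacunarySymmetroidMatrixDescartes
open Summit.ValiantsHypothesis.ValiantsHypothesis.Theorems.LacunarySymmetroidMatrixDescartes.TropicalCensus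
open Summit.ValiantsHypothesis.ValiantsHypothesis.Theses.KPlusLogSqLaw

namespace Doubling

variable {c : ℕ}

/-- **signed law ⇒ unsigned law** (exponent `c ↦ c + 1`). -/
theorem tropRowD_doubling_of_signed
    (hS : ∀ (K a e B₁ B₂ : ℕ), K ≤ a → a ≤ e → e ≤ a + 1 → TropRootLawAt a K B₁ → TropRootLawAt e K B₂ →
      TropRootLawAt (a + e) K ((a + e) ^ c * (B₁ + B₂ + 2))) :
    ∀ (K a e B₁ B₂ : ℕ), K ≤ a → a ≤ e → e ≤ a + 1 → TropRowD a K B₁ → TropRowD e K B₂ →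
      TropRowD (a + e) K ((a + e) ^ (c + 1) * (B₁ + B₂ + 2)) := by
  intro K a e B₁ B₂ hKa hae hea h₁ h₂
  rcases Nat.lt_or_ge (a + e) 2 with hsmall | hbig
  · -- sizes `0` and `1`: slope counting
    have hK : K ≤ 1 := by omega
    rcases Nat.eq_zero_or_pos (a + e) with h0 | hpos
    · rw [h0]; exact tropRowD_size_zero K _
    · have h1 : a + e = 1 := by omega
      rw [h1]
      exact tropRowD_mono (by omega) (tropRowD_one K)
  · have h := tropRowD_of_tropRootLawAt
      (hS K a e B₁ B₂ hKa hae hea (tropRootLawAt_of_tropRowD h₁) (tropRootLawAt_of_tropRowD h₂))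
    refine tropRowD_mono ?_ h
    rw [pow_succ]
    nlinarith [Nat.zero_le ((a + e) ^ c * (B₁ + B₂ + 2))]

/-- **THE SIGNED BALANCED DOUBLING LAW FROM SIZE `K` ON IMPLIES `TropicalB`** (`C = 6(c+3) + 5`).  The hypothesis is NOT claimed. -/
theorem tropicalB_of_signedDoubling
    (hS : ∀ (K a e B₁ B₂ : ℕ), K ≤ a → a ≤ e → e ≤ a + 1 → TropRootLawAt a K B₁ → TropRootLawAt e K B₂ →
      TropRootLawAt (a + e) K ((a + e) ^ c * (B₁ + B₂ + 2))) : TropicalB :=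
  tropicalB_of_doubling_ge (tropRowD_doubling_of_signed hS)

end Doubling

end Summit.ValiantsHypothesis.ValiantsHypothesis.Theorems.KPlusLogSqLaw
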